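/-
Copyright (c) 2026 the pub-hodgecm-mathlib formalisation cell (harness21).  Prover seat hodgecm-mathlib-R90-CS-p03 (g2), R90-TF section S8 «ContSpec-n½» (dealer R90-CS-plan (g3),
S8-R152 (f); census `R90/S8/CENSUS-a7-IntertwinedSectionProfile.R90-CS-p03-g2.md`; file (a-7)): the (ii)-row letters `hφt`, `hg₀`, `hφtbd` of ★ (V) assembly p863385 for the
NORMALISED INTERTWINED SECTION `φt z g := A_g(z) ∕ A_1(z)`, with the `g`-UNIFORM bound on the ★ (a-3) amplitudes that feeds `hφtbd`.
-/
import Summits.HodgeConjecture.HodgeConjecture.Theorems.K2E1ChiIntertwiningLocalFactorHolomorphicU3   -- ★ (a-3) (this seat): amplitude shape, `integral_integral_archWeight_mul_arch_cpow_neg_eq`; brings ★ window engine (`norm_integral_cpow_neg_mul_le`), ★ (C), ★ arch integrability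
import HarnessLib

/-!
# K2·E1 ∕ R90·S8 — `K2E1ChiIntertwinedSectionProfileU3` (file (a-7)): THE NORMALISED INTERTWINED SECTION `φt = A_g ∕ A_1` — CONTINUITY AT `3∕2`, `φt(3∕2, 1) = 1 ≠ 0`, AND THE
# `g`-UNIFORM PROFILE BOUND `‖φt(3∕2, g)‖ ≤ M ∕ ‖A_1(3∕2)‖` FROM THE UNIFORM AMPLITUDE BOUND `‖A_g(z)‖ ≤ ‖C‖·(∫ ARCH₃^{−Re z})·∏_{v∈S₀} ν_v(𝒪_v³)⁻¹∫Q_v^{−Re z}`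

Cell `pub/hodgecm-mathlib`, crux h413 = `stmt-HodgeConjecture-24833`, route of record `HCCMUnconditional`; R90-TF section S8 «ContSpec-n½», road R2-χ₃ (the (V) scalar road; ★ (V) ASSEMBLY
`R90S8ResGMidBlockNeBotAssemblyU3.resGMidBlock_ne_bot_assembly` rows (ii): `hfac : ψ z g = qc z · φt z g`, `hφt : ContinuousAt (φt · g) (3∕2)`, `hg₀ : φt (3∕2) g₀ ≠ 0`,
`hφtbd : ‖φt (3∕2) g‖ ≤ Cφt`).  THEOREMS ONLY (no `def`, no `instance`, no notation, no named-fact hypothesis, no `sorry`; default heartbeats); lane `--supports stmt-HodgeConjecture-24833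
--as helper` (count-neutral).  Closes no socket.

THE MATHEMATICS ([MoeglinWaldspurger1995] II.1.7, IV.1.11; [Langlands1976] Appendix; [Rogawski1990] §13.9 p. 229).  The `H^{2−z}`-coefficient `ψ(z, g)` of the constant term of `E(φ_z)` is
the unipotent integral of the `g`-TRANSLATED section; by ★ (a-2b) each translate factorises as `A_g(z)·c_χ^S(z)` with the SAME good-place Euler quotient and a `g`-dependent amplitude
`A_g(z) = C·(∫_{L_∞}∫_{L⁺_∞} ω_{∞,g}·ARCH₃^{−z})·∏_{v∈S₀} ν_v(𝒪_v³)⁻¹∫ ω_{v,g}·Q_v^{−z}` (★ (a-3)'s shape; `A_1 = A` of ★ F5's `hsrc`).  Hence on `{2 < Re z}` the scattering SCALAR divides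
out: `ψ(z,g) = q(z)·φt(z,g)` with **`φt(z, g) := A_g(z) ∕ A_1(z)`**, `φt(z, 1) = 1`.  Its (V)-letters are ELEMENTARY and UNIFORM IN `g`: continuity at `3∕2` from holomorphy of `A_g, A_1` on
`{1 < Re}` (★ (a-3)) and `A_1(3∕2) ≠ 0` (★ F5's `hA32`); `g₀ := 1`; and the profile bound from the UNIFORM amplitude bound `‖A_g(z)‖ ≤ M(Re z)` valid for EVERY weight family of modulus `≤ 1`
(`‖∫ ω·K^{−z}‖ ≤ ∫ K^{−Re z}`, ★ `norm_integral_cpow_neg_mul_le`, ★ (C) and ★ arch integrability) — `M` does not see `g`.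
* §1 **`norm_chiAmplitude_le_three`** — the `g`-uniform bound on ★ (a-3)'s amplitude `C·(∫ Ξ, ∫ a, ωinf·ARCH₃^{−z})·∏_{v∈S₀} m_v(z)`, `1 < Re z`, all weights a.e.-measurable of modulus `≤ 1`.
* §2 HEAD **`normalisedSection_letters`** — for `A₁` holomorphic on `{1<Re}` with `A₁(3∕2) ≠ 0` and a family `Ag : G → ℂ → ℂ` holomorphic on `{1<Re}` with `Ag g₁ = A₁` and `‖Ag g (3∕2)‖ ≤ M`:
  `(∀ g, ContinuousAt (z ↦ Ag g z ∕ A₁ z) (3∕2)) ∧ Ag g₁ (3∕2) ∕ A₁ (3∕2) ≠ 0 ∧ ∀ g, ‖Ag g (3∕2) ∕ A₁ (3∕2)‖ ≤ M ∕ ‖A₁ (3∕2)‖` — rows `hφt`, `hg₀` (`g₀ := g₁ = 1`), `hφtbd`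
  (`Cφt := M ∕ ‖A₁(3∕2)‖`) of ★ p863385 for `φt := fun z g => Ag g z ∕ A₁ z` (spelt as a lambda; no `def`).
HONEST SCOPE.  NOT here: `hfac` itself on the punctured neighbourhood of `3∕2` (= identity-theorem transfer of the `{2<Re}` factorisation along the continuation of `ψ(·,g)` — ℓ-CT side,
K2E1-p12 (g5) S8-R152 (b), or a follow-up (a-8)), and the per-`g` section-factorisation data `(ω_{∞,g}, ω_{v,g})` (★ (a-2b)'s letter `hfac` for translates; the Iwasawa bricks).
HONEST LABEL: HC_CM is proved only modulo the 7 printed citations (2 remaining named inputs: hLiu418 = `stmt-HodgeConjecture-24832`, h413 = `stmt-HodgeConjecture-24833`) until rung 0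
closes; REL ≠ ★ ≠ BUILT; this file asserts no named fact and closes no socket; count-neutral.

## References
* [MoeglinWaldspurger1995] C. Mœglin, J.-L. Waldspurger, *Spectral Decomposition and Eisenstein Series* (1995): II.1.7, IV.1.11.
* [Langlands1976] R. P. Langlands, *On the Functional Equations Satisfied by Eisenstein Series*, LNM 544 (1976): Appendix (rank one).
* [Rogawski1990] J. D. Rogawski, *Automorphic Representations of Unitary Groups in Three Variables*, Ann. of Math. Stud. 123 (1990): §13.9 p. 229.
-/

set_option autoImplicit false
set_option linter.dupNamespace false -- the mandated namespace repeats `HodgeConjecture.HodgeConjecture`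

noncomputable section

open MeasureTheory MeasureTheory.Measure NumberField NumberField.InfinitePlace IsDedekindDomain Filter Set Topology
open scoped NNReal ENNReal
open Literature.NumberTheory.Automorphic Literature.NumberTheory.Automorphic.UnitaryGroup Literature.NumberTheory.GaloisRepresentations
open Literature.NumberTheory.GaloisRepresentations.IsNonarchimedeanLocalField
open Summit.HodgeConjecture.HodgeConjecture.Cruxes.H413
open Summit.HodgeConjecture.HodgeConjecture.Cruxes.H413.K2E1WhittakerTokenWindowU3 (norm_integral_cpow_neg_mul_le)
open Summit.HodgeConjecture.HodgeConjecture.Cruxes.H413.K2E1IntertwiningLocalFactorBadPlaceSplitU3 (integrable_localHeight_rpow_neg)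
open Summit.HodgeConjecture.HodgeConjecture.Cruxes.H413.K2E1IntertwiningArchFactorIntegrableU3 (one_le_arch integrable_arch_rpow_neg_prod_real)
open Summit.HodgeConjecture.HodgeConjecture.Cruxes.H413.K2E1ChiIntertwiningLocalFactorHolomorphicU3 (integral_integral_archWeight_mul_arch_cpow_neg_eq)

namespace Summit.HodgeConjecture.HodgeConjecture.Cruxes.H413.K2E1ChiIntertwinedSectionProfileU3

variable (L : Type) [Field L] [NumberField L] [IsCMField L] {δ : L} (hcδ : IsCMField.complexConj L δ = -δ) (hδ : δ ≠ 0)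
  {d : ↥(maximalRealSubfield L)} (hd : δ * δ = algebraMap ↥(maximalRealSubfield L) L d)

/-! ## §1 The `g`-uniform bound on ★ (a-3)'s amplitude -/

section Finite

variable (v : HeightOneSpectrum (𝓞 ↥(maximalRealSubfield L)))
  [MeasurableSpace (v.adicCompletion ↥(maximalRealSubfield L))] [BorelSpace (v.adicCompletion ↥(maximalRealSubfield L))] (νv : Measure (v.adicCompletion ↥(maximalRealSubfield L))) [νv.IsAddHaarMeasure]

include hd in
/-- **`‖m_v(z)‖ ≤ ν_v(𝒪_v³)⁻¹ • ∫ Q_v^{−Re z}`** for every weight of modulus `≤ 1` (`1 < Re z`; ★ `norm_integral_cpow_neg_mul_le` at `σ₁ := Re z` with ★ (C)). [cite: MoeglinWaldspurger1995, IV.1.11] -/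
theorem norm_chiLocalMean_le (ω : (Fin 3 → v.adicCompletion ↥(maximalRealSubfield L)) → ℂ) (hωb : ∀ p, ‖ω p‖ ≤ 1) {z : ℂ} (hz : 1 < z.re) :
    ‖((Measure.pi fun _ : Fin 3 => νv) (integralBox ↥(maximalRealSubfield L) (Fin 3) v)).toReal⁻¹ •
        ∫ p : Fin 3 → v.adicCompletion ↥(maximalRealSubfield L), ω p * ((((∏ w' : PlacesOver L v, max 1 (max ((normAbs (w'.1.adicCompletion L) (quadraticLocalEquiv L v (IsCMField.complexConj L) hcδ hδ (p 0, p 1) w') : ℝ≥0) : ℝ)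
            ((normAbs (w'.1.adicCompletion L) ((toLocalRing L v (p 2) * algebraMap L (LocalRing L v) δ -
              toLocalRing L v 2⁻¹ * (quadraticLocalEquiv L v (IsCMField.complexConj L) hcδ hδ (p 0, p 1) *
                conjLocal L (IsCMField.complexConj L) v (quadraticLocalEquiv L v (IsCMField.complexConj L) hcδ hδ (p 0, p 1)))) w') : ℝ≥0) : ℝ)))) : ℝ) : ℂ) ^ (-z) ∂(Measure.pi fun _ : Fin 3 => νv)‖ ≤
      ((Measure.pi fun _ : Fin 3 => νv) (integralBox ↥(maximalRealSubfield L) (Fin 3) v)).toReal⁻¹ *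
        ∫ p : Fin 3 → v.adicCompletion ↥(maximalRealSubfield L), (∏ w' : PlacesOver L v, max 1 (max ((normAbs (w'.1.adicCompletion L) (quadraticLocalEquiv L v (IsCMField.complexConj L) hcδ hδ (p 0, p 1) w') : ℝ≥0) : ℝ)
            ((normAbs (w'.1.adicCompletion L) ((toLocalRing L v (p 2) * algebraMap L (LocalRing L v) δ -
              toLocalRing L v 2⁻¹ * (quadraticLocalEquiv L v (IsCMField.complexConj L) hcδ hδ (p 0, p 1) *
                conjLocal L (IsCMField.complexConj L) v (quadraticLocalEquiv L v (IsCMField.complexConj L) hcδ hδ (p 0, p 1)))) w') : ℝ≥0) : ℝ))) ^ (-z.re) ∂(Measure.pi fun _ : Fin 3 => νv) := by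
  rw [norm_smul, Real.norm_of_nonneg (inv_nonneg.2 ENNReal.toReal_nonneg)]
  refine mul_le_mul_of_nonneg_left ?_ (inv_nonneg.2 ENNReal.toReal_nonneg)
  have h := norm_integral_cpow_neg_mul_le (Measure.pi fun _ : Fin 3 => νv) (χ := ω) (fun p => Finset.one_le_prod fun w' _ => le_max_left _ _) hωb
    (integrable_localHeight_rpow_neg L hcδ hδ hd v νv hz) (le_refl z.re)
  rw [integral_congr_ae (Eventually.of_forall fun p => mul_comm (ω p) _)]
  exact h

end Finite

section Amplitude

variable [MeasurableSpace (InfiniteAdeleRing L)] [BorelSpace (InfiniteAdeleRing L)]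
  [MeasurableSpace (InfiniteAdeleRing ↥(maximalRealSubfield L))] [BorelSpace (InfiniteAdeleRing ↥(maximalRealSubfield L))]
  (μE₁ : Measure (InfiniteAdeleRing L)) [μE₁.IsAddHaarMeasure] (μF₁ : Measure (InfiniteAdeleRing ↥(maximalRealSubfield L))) [μF₁.IsAddHaarMeasure]
  [∀ v : HeightOneSpectrum (𝓞 ↥(maximalRealSubfield L)), MeasurableSpace (v.adicCompletion ↥(maximalRealSubfield L))] [∀ v : HeightOneSpectrum (𝓞 ↥(maximalRealSubfield L)), BorelSpace (v.adicCompletion ↥(maximalRealSubfield L))]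
  (νv : ∀ v : HeightOneSpectrum (𝓞 ↥(maximalRealSubfield L)), Measure (v.adicCompletion ↥(maximalRealSubfield L))) [∀ v, (νv v).IsAddHaarMeasure]

omit [∀ v : HeightOneSpectrum (𝓞 ↥(maximalRealSubfield L)), MeasurableSpace (v.adicCompletion ↥(maximalRealSubfield L))]
  [∀ v : HeightOneSpectrum (𝓞 ↥(maximalRealSubfield L)), BorelSpace (v.adicCompletion ↥(maximalRealSubfield L))] in
include hδ in
/-- **`‖∫_{L_∞}∫_{L⁺_∞} ω_∞·ARCH₃^{−z}‖ ≤ ∫ ARCH₃^{−Re z} d(μ_{E,∞}⊗μ_{F,∞})`** for every a.e.-measurable archimedean weight of modulus `≤ 1` (`1 < Re z`; iterated = product ★ (a-3), then ★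
`norm_integral_cpow_neg_mul_le` with ★ `integrable_arch_rpow_neg_prod_real`). [cite: MoeglinWaldspurger1995, II.1.7] -/
theorem norm_integral_integral_archWeight_le (ωinf : InfiniteAdeleRing L → InfiniteAdeleRing ↥(maximalRealSubfield L) → ℂ)
    (hω : AEStronglyMeasurable (fun p : InfiniteAdeleRing L × InfiniteAdeleRing ↥(maximalRealSubfield L) => ωinf p.1 p.2) (μE₁.prod μF₁)) (hωb : ∀ Xi a, ‖ωinf Xi a‖ ≤ 1) {z : ℂ} (hz : 1 < z.re) :
    ‖∫ Xi : InfiniteAdeleRing L, ∫ a : InfiniteAdeleRing ↥(maximalRealSubfield L), ωinf Xi a * ((((∏ w : InfinitePlace L, ((1 + ‖(Xi) w‖ ^ 2 / 2) ^ 2 + (w δ) ^ 2 * (((InfiniteAdeleRing.ringEquiv_mixedSpace ↥(maximalRealSubfield L)) a).1 ⟨w.comap (algebraMap ↥(maximalRealSubfield L) L), K2E1HeightBigCellLineFormulaU2.isReal_comap_maximalRealSubfield L w⟩) ^ 2))) : ℝ) : ℂ) ^ (-z) ∂μF₁ ∂μE₁‖ ≤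
      ∫ p : InfiniteAdeleRing L × InfiniteAdeleRing ↥(maximalRealSubfield L), (∏ w : InfinitePlace L, ((1 + ‖(p.1) w‖ ^ 2 / 2) ^ 2 + (w δ) ^ 2 * (((InfiniteAdeleRing.ringEquiv_mixedSpace ↥(maximalRealSubfield L)) p.2).1 ⟨w.comap (algebraMap ↥(maximalRealSubfield L) L), K2E1HeightBigCellLineFormulaU2.isReal_comap_maximalRealSubfield L w⟩) ^ 2)) ^ (-z.re) ∂(μE₁.prod μF₁) := by
  rw [integral_integral_archWeight_mul_arch_cpow_neg_eq L hδ μE₁ μF₁ ωinf hω hωb hz,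
    integral_congr_ae (Eventually.of_forall fun p : InfiniteAdeleRing L × InfiniteAdeleRing ↥(maximalRealSubfield L) => mul_comm (ωinf p.1 p.2) _)]
  exact norm_integral_cpow_neg_mul_le (μE₁.prod μF₁) (χ := fun p : InfiniteAdeleRing L × InfiniteAdeleRing ↥(maximalRealSubfield L) => ωinf p.1 p.2) (fun p => one_le_arch L p.1 p.2) (fun p => hωb p.1 p.2)
    (integrable_arch_rpow_neg_prod_real L hδ μE₁ μF₁ hz) (le_refl z.re)

include hd in
/-- **THE `g`-UNIFORM AMPLITUDE BOUND**: for `1 < Re z`, every constant `C`, every bad finset `S₀`, EVERY finite weight family `‖ω_v‖ ≤ 1` and archimedean weight `‖ω_∞‖ ≤ 1` (a.e.-measurable),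
`‖C·(∫ Ξ, ∫ a, ω_∞·ARCH₃^{−z})·∏_{v∈S₀} m_v(z)‖ ≤ ‖C‖·(∫ ARCH₃^{−Re z} d(μ_{E,∞}⊗μ_{F,∞}))·∏_{v∈S₀} ν_v(𝒪_v³)⁻¹∫Q_v^{−Re z}` — the right side does not see the weights, hence not the
translate `g`. [cite: MoeglinWaldspurger1995, II.1.7, IV.1.11] -/
theorem norm_chiAmplitude_le_three (C : ℂ) (S₀ : Finset (HeightOneSpectrum (𝓞 ↥(maximalRealSubfield L))))
    (ω : ∀ v : HeightOneSpectrum (𝓞 ↥(maximalRealSubfield L)), (Fin 3 → v.adicCompletion ↥(maximalRealSubfield L)) → ℂ) (hωb : ∀ v ∈ S₀, ∀ p, ‖ω v p‖ ≤ 1)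
    (ωinf : InfiniteAdeleRing L → InfiniteAdeleRing ↥(maximalRealSubfield L) → ℂ)
    (hωinf : AEStronglyMeasurable (fun p : InfiniteAdeleRing L × InfiniteAdeleRing ↥(maximalRealSubfield L) => ωinf p.1 p.2) (μE₁.prod μF₁)) (hωinfb : ∀ Xi a, ‖ωinf Xi a‖ ≤ 1) {z : ℂ} (hz : 1 < z.re) :
    ‖C * (∫ Xi : InfiniteAdeleRing L, ∫ a : InfiniteAdeleRing ↥(maximalRealSubfield L),
        ωinf Xi a * ((((∏ w : InfinitePlace L, ((1 + ‖(Xi) w‖ ^ 2 / 2) ^ 2 + (w δ) ^ 2 * (((InfiniteAdeleRing.ringEquiv_mixedSpace ↥(maximalRealSubfield L)) a).1 ⟨w.comap (algebraMap ↥(maximalRealSubfield L) L), K2E1HeightBigCellLineFormulaU2.isReal_comap_maximalRealSubfield L w⟩) ^ 2))) : ℝ) : ℂ) ^ (-z) ∂μF₁ ∂μE₁) *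
      ∏ v ∈ S₀, ((Measure.pi fun _ : Fin 3 => νv v) (integralBox ↥(maximalRealSubfield L) (Fin 3) v)).toReal⁻¹ •
        ∫ p : Fin 3 → v.adicCompletion ↥(maximalRealSubfield L),
          ω v p * ((((∏ w' : PlacesOver L v, max 1 (max ((normAbs (w'.1.adicCompletion L) (quadraticLocalEquiv L v (IsCMField.complexConj L) hcδ hδ (p 0, p 1) w') : ℝ≥0) : ℝ)
            ((normAbs (w'.1.adicCompletion L) ((toLocalRing L v (p 2) * algebraMap L (LocalRing L v) δ -
              toLocalRing L v 2⁻¹ * (quadraticLocalEquiv L v (IsCMField.complexConj L) hcδ hδ (p 0, p 1) *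
                conjLocal L (IsCMField.complexConj L) v (quadraticLocalEquiv L v (IsCMField.complexConj L) hcδ hδ (p 0, p 1)))) w') : ℝ≥0) : ℝ)))) : ℝ) : ℂ) ^ (-z) ∂(Measure.pi fun _ : Fin 3 => νv v)‖ ≤
      ‖C‖ * (∫ p : InfiniteAdeleRing L × InfiniteAdeleRing ↥(maximalRealSubfield L), (∏ w : InfinitePlace L, ((1 + ‖(p.1) w‖ ^ 2 / 2) ^ 2 + (w δ) ^ 2 * (((InfiniteAdeleRing.ringEquiv_mixedSpace ↥(maximalRealSubfield L)) p.2).1 ⟨w.comap (algebraMap ↥(maximalRealSubfield L) L), K2E1HeightBigCellLineFormulaU2.isReal_comap_maximalRealSubfield L w⟩) ^ 2)) ^ (-z.re) ∂(μE₁.prod μF₁)) *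
        ∏ v ∈ S₀, ((Measure.pi fun _ : Fin 3 => νv v) (integralBox ↥(maximalRealSubfield L) (Fin 3) v)).toReal⁻¹ *
          ∫ p : Fin 3 → v.adicCompletion ↥(maximalRealSubfield L), (∏ w' : PlacesOver L v, max 1 (max ((normAbs (w'.1.adicCompletion L) (quadraticLocalEquiv L v (IsCMField.complexConj L) hcδ hδ (p 0, p 1) w') : ℝ≥0) : ℝ)
            ((normAbs (w'.1.adicCompletion L) ((toLocalRing L v (p 2) * algebraMap L (LocalRing L v) δ -
              toLocalRing L v 2⁻¹ * (quadraticLocalEquiv L v (IsCMField.complexConj L) hcδ hδ (p 0, p 1) *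
                conjLocal L (IsCMField.complexConj L) v (quadraticLocalEquiv L v (IsCMField.complexConj L) hcδ hδ (p 0, p 1)))) w') : ℝ≥0) : ℝ))) ^ (-z.re) ∂(Measure.pi fun _ : Fin 3 => νv v) := by
  rw [norm_mul, norm_mul]
  refine mul_le_mul (mul_le_mul_of_nonneg_left (norm_integral_integral_archWeight_le L hδ μE₁ μF₁ ωinf hωinf hωinfb hz) (norm_nonneg C)) ?_ (norm_nonneg _)
    (mul_nonneg (norm_nonneg C) (integral_nonneg fun p => Real.rpow_nonneg (le_trans zero_le_one (one_le_arch L p.1 p.2)) _))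
  refine le_trans (Finset.norm_prod_le _ _) (Finset.prod_le_prod (fun v _ => norm_nonneg _) fun v hv => ?_)
  exact norm_chiLocalMean_le L hcδ hδ hd v (νv v) (ω v) (hωb v hv) hz

end Amplitude

/-! ## §2 HEAD: the (V)-letters of the normalised intertwined section `φt := A_g ∕ A_1` -/

/-- **THE LETTERS `hφt`, `hg₀`, `hφtbd` OF ★ (V) ASSEMBLY p863385 FOR `φt z g := Ag g z ∕ A₁ z`** — `A₁` holomorphic on `{1 < Re}` with `A₁(3∕2) ≠ 0` (★ F5's `hA`, `hA32`), `Ag : G → ℂ → ℂ`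
the amplitudes of the translated sections (each holomorphic on `{1 < Re}`, ★ (a-3)), `Ag g₁ = A₁` (the untranslated section, `g₁ = 1`), and the `g`-UNIFORM bound `‖Ag g (3∕2)‖ ≤ M` (§1):
THEN `z ↦ φt z g` is continuous at `3∕2` for every `g`, `φt (3∕2) g₁ = 1 ≠ 0`, and `‖φt (3∕2) g‖ ≤ M ∕ ‖A₁(3∕2)‖` for every `g` — rows `hφt`, `hg₀` (`g₀ := g₁`), `hφtbd`
(`Cφt := M ∕ ‖A₁ (3∕2)‖`). [cite: MoeglinWaldspurger1995, IV.1.11] [cite: Langlands1976, Appendix] -/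
theorem normalisedSection_letters {G : Type*} (A₁ : ℂ → ℂ) (hA : DifferentiableOn ℂ A₁ {z : ℂ | 1 < z.re}) (hA32 : A₁ (3 / 2) ≠ 0)
    (Ag : G → ℂ → ℂ) (hAg : ∀ g, DifferentiableOn ℂ (Ag g) {z : ℂ | 1 < z.re}) (g₁ : G) (hAg1 : Ag g₁ = A₁) {M : ℝ} (hM : ∀ g, ‖Ag g (3 / 2)‖ ≤ M) :
    (∀ g, ContinuousAt (fun z => Ag g z / A₁ z) ((3 : ℂ) / 2)) ∧ Ag g₁ ((3 : ℂ) / 2) / A₁ ((3 : ℂ) / 2) ≠ 0 ∧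
      ∀ g, ‖Ag g ((3 : ℂ) / 2) / A₁ ((3 : ℂ) / 2)‖ ≤ M / ‖A₁ ((3 : ℂ) / 2)‖ := by
  have hopen : IsOpen {z : ℂ | 1 < z.re} := isOpen_lt continuous_const Complex.continuous_re
  have hmem : ((3 : ℂ) / 2) ∈ {z : ℂ | 1 < z.re} := by
    show (1 : ℝ) < ((3 : ℂ) / 2).re
    norm_num
  refine ⟨fun g => ?_, ?_, fun g => ?_⟩
  · exact (((hAg g).differentiableAt (hopen.mem_nhds hmem)).continuousAt).div ((hA.differentiableAt (hopen.mem_nhds hmem)).continuousAt) hA32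
  · rw [hAg1]
    exact div_ne_zero hA32 hA32
  · rw [norm_div]
    exact div_le_div_of_nonneg_right (hM g) (norm_nonneg _)

end Summit.HodgeConjecture.HodgeConjecture.Cruxes.H413.K2E1ChiIntertwinedSectionProfileU3

end
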